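import Summits.QuantumFields.YangMills.Theorems.IsotropyFromPowerCountingTemperedCurvatureMomentsOfBddRenormalisation
import Summits.QuantumFields.YangMills.Theorems.MirrorModularBoostsSoftKernelBoostCovarianceStepZeroOfLattice

/-!
# `CurvatureDensities` (Step 0) along bounded-renormalisation schemes

Support file for the item `IsotropyFromPowerCounting.CurvatureDensities` (stmt-QuantumFields-17723, the monolithic Step 0
`W1 → EightFrameRP → PlanarCone → NPointRegular S₁` of the three engine lines 9663 / 11686 / 14999); lead c5 of crux
stmt-QuantumFields-14999 (line `Sketch`).

The item as filed is a Yang–Mills input (c4: it is T's corollary only).  Here it is PROVED on the degenerate sector: for every family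
`S₁` tied to a scheme whose curvature species has bounded multiplicative renormalisation (`|c_k| ≤ B`), every `𝔖ₙ|⁰𝒮` is integration
against a function — `NPointRegular S₁` — by the landed pointwise Step-0 glue `stub_stepZeroOfLattice` (normalisation + tempered tied
lattice approximants ⇒ `NPointRegular`, p137944) fed with the tempered TRUE densities of
`IsotropyFromPowerCountingTemperedCurvatureMomentsOfBddRenormalisation.lean` (p140303).  Only the tie and E0 of `W1` are used.
In particular no junk-type (singular, non-`NPointRegular`) family is a tied limit along such a scheme: every obstruction of that kind,
like the whole content of the item, lives at `sup_k |c_k| = ∞`.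

References: Osterwalder–Schrader 1973 §2; Glimm–Jaffe 1987 §6.1.
-/

noncomputable section

open scoped SchwartzMap BigOperators
open MeasureTheory Filter Topology
open Literature.MathematicalPhysics.QuantumFieldTheory Literature.MathematicalPhysics.QuantumLattice
open Literature.MathematicalPhysics.AQFT
open Literature.Probability.LatticeModels (box Site)
open Summit.QuantumFields.YangMills.Theorems.OSLegsFromFemtoAndGap (torusMoment)
open Summit.QuantumFields.YangMills.Theorems.CurvatureBoostCovariance.Negative (Tie W1 EightFrameRP PlanarCone)
open Summit.QuantumFields.YangMills.Theorems.NPointIsotropy.Negative (E4 NPointRegular)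

namespace Summit.QuantumFields.YangMills.Theorems.SoftKernelBoostCovariance.Sketch

variable {G : Type} [Group G] [TopologicalSpace G] [IsTopologicalGroup G] [CompactSpace G]
  [MeasurableSpace G] [BorelSpace G]

/-- **Tempered approximants of every degree along a bounded-renormalisation tied scheme (pointwise form).**  Tie + `|c_k| ≤ B`
give, for each `n ≥ 1`, the conclusion of T at `(r, sch, S₁, n)` with the true densities (bounded by `(2BM+K)ⁿ`, `N = 0`). -/
theorem temperedApproximants_of_tie_of_bdd (r : LatticeRep G) (sch : SpeciesScheme (YMSpecies G)) (S₁ : SchwingerFamily E4)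
    (htie : Tie r sch S₁) (hB : ∃ B : ℝ, ∀ k : ℕ, |sch.c r.curvature k| ≤ B) {n : ℕ} (hn : 0 < n) :
    ∃ (D : ℕ → (Fin n → Site 4) → ℝ) (C : ℝ) (N k₀ : ℕ), 0 < C ∧
      (∀ k : ℕ, k₀ ≤ k → ∀ x : Fin n → Site 4, (∀ i, x i ∈ box 4 (sch.L k)) → Function.Injective x →
        |D k x| ≤ C * (1 + ‖fun i => sch.a k • siteToE (x i)‖) ^ N *
          (1 + ∑ i, ∑ j ∈ Finset.univ.erase i,
            ‖sch.a k • siteToE (x i) - sch.a k • siteToE (x j)‖⁻¹) ^ N) ∧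
      ∀ (f : Fin n → SchwartzMap E4 ℝ) (F : SchwartzMap (Fin n → E4) ℂ),
        IsTensorOf F (fun i => ofRealTest (f i)) → IsOffDiagonal F →
        Filter.Tendsto (fun k => (((sch.a k ^ 4) ^ n *
          ∑ x ∈ Fintype.piFinset (fun _ : Fin n => box 4 (sch.L k)),
            (∏ i, f i (sch.a k • siteToE (x i))) * D k x : ℝ) : ℂ)) Filter.atTop (nhds (S₁ n F)) := by
  obtain ⟨B, hB⟩ := hB
  obtain ⟨M, hM⟩ := r.curvature.bounded
  obtain ⟨K, hK⟩ := eventually_abs_renormalisedMean_le r sch S₁ htie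
  obtain ⟨k₁, hk₁⟩ := eventually_atTop.1 hK
  have hM0 : 0 ≤ M := (abs_nonneg _).trans (hM fun _ => 1)
  have hB0 : 0 ≤ B := (abs_nonneg _).trans (hB 0)
  have hK0 : 0 ≤ K := (abs_nonneg _).trans (hk₁ k₁ le_rfl)
  refine temperedCurvatureMoments_of_trueDensity_tempered r sch S₁ htie hn
    ⟨(2 * B * M + K) ^ n + 1, 0, k₁, by positivity, fun k hk x _ _ => ?_⟩
  calc |(sch.c r.curvature k) ^ n * torusMoment r.ρ (sch.β k) (sch.L k) r.curvature.F (sch.m r.curvature k) x|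
      ≤ (2 * B * M + K) ^ n := abs_trueDensity_le r sch hM k (hB k) (hk₁ k hk) x
    _ ≤ ((2 * B * M + K) ^ n + 1) * (1 + ‖fun i => sch.a k • siteToE (x i)‖) ^ (0 : ℕ) *
          (1 + ∑ i, ∑ j ∈ Finset.univ.erase i,
            ‖sch.a k • siteToE (x i) - sch.a k • siteToE (x j)‖⁻¹) ^ (0 : ℕ) := by
        simp

/-- **STEP 0 (`CurvatureDensities`) ALONG BOUNDED-RENORMALISATION SCHEMES.**  For every family `S₁` tied to `(r, sch)` with E0
(here: `W1 r sch S₁`) and bounded multiplicative renormalisation of the curvature species, `|c_k| ≤ B`: every `𝔖ₙ` restricted to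
`⁰𝒮` is integration against a function, `NPointRegular S₁` (the pointwise glue `stub_stepZeroOfLattice`, p137944, on the tempered
true densities).  The eight frames and the cone of the item are not needed. -/
theorem nPointRegular_of_bddRenormalisation (r : LatticeRep G) (sch : SpeciesScheme (YMSpecies G)) (S₁ : SchwingerFamily E4)
    (hW : W1 r sch S₁) (hB : ∃ B : ℝ, ∀ k : ℕ, |sch.c r.curvature k| ≤ B) : NPointRegular S₁ :=
  stub_stepZeroOfLattice sch.a sch.L S₁ sch.a_pos sch.tendsto_a sch.tendsto_L hW.2.1.1
    (fun _ hn => temperedApproximants_of_tie_of_bdd r sch S₁ hW.1 hB hn)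

/-- **The item `CurvatureDensities` restricted to bounded renormalisation** (its shape with the one extra hypothesis). -/
theorem curvatureDensities_of_bddRenormalisation :
    ∀ (G : Type) [Group G] [TopologicalSpace G] [IsTopologicalGroup G] [CompactSpace G]
      [MeasurableSpace G] [BorelSpace G], IsCompactSimpleLieGroup G →
      ∀ (r : LatticeRep G) (sch : SpeciesScheme (YMSpecies G)) (S₁ : SchwingerFamily E4),
        W1 r sch S₁ → EightFrameRP S₁ → PlanarCone S₁ →
        (∃ B : ℝ, ∀ k : ℕ, |sch.c r.curvature k| ≤ B) → NPointRegular S₁ :=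
  fun _G _ _ _ _ _ _ _ r sch S₁ hW _ _ hB => nPointRegular_of_bddRenormalisation r sch S₁ hW hB

end Summit.QuantumFields.YangMills.Theorems.SoftKernelBoostCovariance.Sketch

end
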